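import Mathlib.MeasureTheory.Measure.Haar.Basic
import Mathlib.MeasureTheory.Group.Integral
import Literature.NumberTheory.Automorphic.ArchimedeanLieBracket
import HarnessLib

/-!
# Harish-Chandra's convolution identity `φ = φ ∗ α` for automorphic forms on `GL_n(𝔸_K)`
(the deep input of Step 2 of Borel–Jacquet 4.6, as one named fact) and the calculus of the weight

Topic `NumberTheory/Automorphic`. Let `φ` be an automorphic form on `GL_n(𝔸_K)` (smooth in the
archimedean variable, `K_∞`-finite, `Z(𝔤)`-finite, of some level). Harish-Chandra's theorem
(Harish-Chandra 1966, Thm. 1; for a `K`-finite `Z(𝔤)`-finite smooth vector `v` of a permissible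
continuous representation of a connected reductive Lie group there is `α ∈ C_c^∞(G)` with
`π(α) v = v`: Borel 1972, Thm. 3.18 and Cor. 3.19; Borel 1997, Thm. 2.14 and 5.6 (b):
"there exists `α ∈ I_c^∞(G)` such that `f = f ∗ α`"), in the form used by Borel–Jacquet 1979, 4.3
for reductive `G` (after the reduction to the identity component and the splitting off of the
connected centre recorded in the docstring of the fact), gives a smooth compactly supported `α` on
`GL_n(K_∞)` with `φ(g) = ∫_{GL_n(K_∞)} φ(g x) α(x) dx` for all `g ∈ GL_n(𝔸_K)`. This is the analytic
input from which Borel–Jacquet 1979, 4.3 (ii) (uniform moderate growth, `X φ = φ ∗ α'`) and 4.6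
(`K`-finite vectors of `L²` are differentiable) follow. It is recorded here as the named fact

* `AutomorphicRepsGL.exists_convolution_eq_self hcpt` (for every Haar measure on `GL_n(K_∞)`),

and the elementary calculus of the weight needed downstream is **proved**:

* the measurable / locally compact / second countable structure of `GL_n(K_∞)` (local instances
  `glInfBorel`, …);
* `exists_hasDerivAt_left_translate` — for `α ∈ C_c^∞(GL_n(K_∞))` (smooth in the sense
  `IsArchSmooth` for the full linear group, `Continuous`, `HasCompactSupport`) and `X ∈ 𝔤𝔩_n(K_∞)`
  there is a continuous compactly supported `α_X` with
  `d/ds α(exp(-sX) x) |_{s = t} = α_X (exp(-tX) x)` for all `x`, `t` (the left-invariant derivative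
  `-X̃ α`, through the exponential chart `exists_contDiffAt_log`).

## References

* Harish-Chandra, *Discrete series for semisimple Lie groups. II*, Acta Math. 116 (1966), Thm. 1
  [HarishChandra1966].
* A. Borel, *Représentations de groupes localement compacts*, LNM 276 (1972), Thm. 3.18,
  Cor. 3.19 [Borel1972].
* A. Borel, *Automorphic forms on `SL₂(ℝ)`* (1997), Thm. 2.14, 5.6 (b) [Borel1997].
* A. Borel, H. Jacquet, *Automorphic forms and automorphic representations*, Proc. Sympos. Pure
  Math. 33 (1979), part 1, 4.3 (ii) [BorelJacquet1979].
-/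

noncomputable section

open scoped MatrixGroups Matrix ContDiff Topology Classical
open Filter MeasureTheory NumberField NumberField.mixedEmbedding IsDedekindDomain

namespace Literature.NumberTheory.Automorphic

/-! ### `GL_n(K_∞)` as a measurable locally compact group -/

section Setup

variable (n : ℕ) (K : Type) [Field K] [NumberField K]

/-- The Borel σ-algebra on `GL_n(K_∞) = GL_n(ℝ^{r₁} × ℂ^{r₂})` (a *local* instance below). [folklore] -/
@[reducible] def glInfBorel : MeasurableSpace (GL (Fin n) (mixedSpace K)) := borel _

attribute [local instance] glInfBorel

omit [NumberField K] in
/-- `GL_n(K_∞)` with `glInfBorel` is a Borel space (by definition). [folklore] -/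
theorem borelSpace_glInf : BorelSpace (GL (Fin n) (mixedSpace K)) := ⟨rfl⟩

/-- `GL_n(K_∞)` is locally compact: the unit group of the locally compact Hausdorff topological
ring `M_n(K_∞)` (Mathlib's `LocallyCompactSpace αˣ`). [folklore] -/
theorem locallyCompactSpace_glInf : LocallyCompactSpace (GL (Fin n) (mixedSpace K)) := by
  haveI : LocallyCompactSpace (Matrix (Fin n) (Fin n) (mixedSpace K)) :=
    inferInstanceAs (LocallyCompactSpace (Fin n → Fin n → mixedSpace K))
  infer_instance

/-- `GL_n(K_∞)` is second countable (as a subspace of `M_n(K_∞) × M_n(K_∞)ᵐᵒᵖ`). [folklore] -/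
theorem secondCountableTopology_glInf : SecondCountableTopology (GL (Fin n) (mixedSpace K)) := by
  haveI : SecondCountableTopology (Matrix (Fin n) (Fin n) (mixedSpace K)) :=
    inferInstanceAs (SecondCountableTopology (Fin n → Fin n → mixedSpace K))
  haveI : SecondCountableTopology (Matrix (Fin n) (Fin n) (mixedSpace K))ᵐᵒᵖ :=
    MulOpposite.opHomeomorph.symm.secondCountableTopology
  exact Units.isEmbedding_embedProduct.secondCountableTopology

end Setup

/-! ### Harish-Chandra's convolution identity (named fact) -/

section Fact

variable {n : ℕ} {K : Type} [Field K] [NumberField K]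

variable (hcpt : isCompact_glFiniteIntegralLevel n K) in
/-- **Harish-Chandra's convolution identity for automorphic forms on `GL_n(𝔸_K)`**
(Borel–Jacquet 1979, 4.3, proof of (ii): for `f ∈ 𝒜` there is `α ∈ C_c^∞(G_∞)` with `f ∗ α = f`,
the form in which the tree's Step-2 files consume it): for every automorphic form `φ` on
`GL_n(𝔸_K)` and every Haar measure `ν` on `G_∞ = GL_n(K_∞)` there is a continuous, compactly
supported function `α` on `GL_n(K_∞)`, smooth (`IsArchSmooth` for the full linear group
`GL_n(K_∞)`), such that `φ(g) = ∫ φ(g x) α(x) dν(x)` for all `g ∈ GL_n(𝔸_K)`.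

Proof pointers and the reduction to the printed representation-theoretic statements.
Harish-Chandra's theorem (Harish-Chandra 1966, Thm. 1; Borel 1972, Thm. 3.18: for a smooth
`K`-finite `Z(𝔤)`-finite vector `v` of a *permissible* continuous representation `π` of a
*connected* reductive Lie group and a neighbourhood `U` of `1` there is `α ∈ C_c^∞(U)` with
`π(α) v = v`; Cor. 3.19 for families of functions when the centre is compact; Borel 1997,
Thm. 2.14 and 5.6 (b) for `SL₂(ℝ)`: an automorphic form `f` satisfies `f = f ∗ α`) does not apply
verbatim to the right regular representation of `G_∞` on functions on `GL_n(𝔸_K)`: `G_∞` is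
disconnected and its centre `(ℝ_{>0})^{r₁+r₂} × (compact)` is not compact, and the connected
centre need not act by homotheties on the translates of `φ` (e.g. `n = 1`, `φ = log |det|`, on
which the centre acts unipotently). The reduction: `α` may be taken supported in the identity
component `G_∞⁰ = C · G₁`, `C` the connected centre and `G₁ = ∏_w SL_n` (finite centre, so every
continuous representation of `G₁` is permissible; `K_∞`-finite implies `K₁`-finite and
`Z(𝔤₁) ⊆ Z(𝔤)`); take `α₁ ∈ C_c^∞(G₁)` from Borel 1972, Thm. 3.18, and `α_C ∈ C_c^∞(C)` from the
`𝔷`-finiteness of `φ` (`𝔷 = Lie C ⊆ Z(𝔤) = centerU`, so the `C`-translates of `φ` span a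
finite-dimensional space of smooth functions of the central variable, on which convolution by a
Dirac sequence of `C` tends to the identity in `End` of that space, hence the identity is attained:
the argument of Borel 1997, 2.14), and `α = α_C ⊗ α₁`. (The `Int K`-invariance and the support
condition of the sources are dropped; `∫ φ(g x) α(x) dν` is Borel's `φ ∗ α̌`, `GL_n` being
unimodular.) [cite: BorelJacquet1979, 4.3] -/
def AutomorphicRepsGL.exists_convolution_eq_self : Prop :=
  ∀ [MeasurableSpace (GL (Fin n) (mixedSpace K))] [BorelSpace (GL (Fin n) (mixedSpace K))]
    (ν : Measure (GL (Fin n) (mixedSpace K))) [ν.IsHaarMeasure]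
    (φ : (AdelicGroupData.gl n K).Adelic → ℂ), IsAutomorphicForm (AutomorphyDatum.gl n K hcpt) φ →
      ∃ α : GL (Fin n) (mixedSpace K) → ℂ,
        Continuous α ∧ HasCompactSupport α ∧ IsArchSmooth (archGroupGL n K).carrier.subtype α ∧
          ∀ g : GL (Fin n) (AdeleRing (𝓞 K) K),
            φ g = ∫ x, φ (g * GLn.ofInfinite n K x) * α x ∂ν

end Fact

/-! ### Calculus of the weight: the left-invariant derivative of a test function -/

section Weight

variable {A : Type*} [NormedCommRing A] [NormedAlgebra ℝ A] [NormedAlgebra ℚ A] [CompleteSpace A]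
  [StarRing A] {N : Type*} [Fintype N] [DecidableEq N] {H : RealMatrixGroup A N}

set_option backward.isDefEq.respectTransparency false in
open scoped Matrix.Norms.Operator in
/-- **Smooth functions on the full linear group are smooth on the open set of invertible
matrices.** If `H.lie = ⊤`, `A` is finite-dimensional and `α : GL(N, A) → ℂ` is smooth in the sense
of `IsArchSmooth` for the inclusion `H.carrier.subtype` (i.e. `Y ↦ α (u exp Y)` is `C^∞` for every
`u`), then `M ↦ α(M)` (junk at non-invertible `M`) is `C^∞` at every invertible matrix: near `u₀`,
`α(M) = α(u₀ exp (log (u₀⁻¹ M)))`. [folklore] -/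
theorem contDiffAt_extend_of_isArchSmooth [FiniteDimensional ℝ A] (hH : H.lie = ⊤)
    {α : GL N A → ℂ} (hα : IsArchSmooth H.carrier.subtype α) (u₀ : GL N A) :
    ContDiffAt ℝ ∞ (fun M : Matrix N N A => α (if h : IsUnit M then h.unit else 1))
      (u₀ : Matrix N N A) := by
  classical
  -- Mathlib idiom (Mathlib/Algebra/Lie/OfAssociative.lean): the commutator Lie ring on matrices
  letI : LieRing (Matrix N N A) := LieRing.ofAssociativeRing
  have hmem : ∀ M : Matrix N N A, M ∈ H.lie := fun M => by rw [hH]; exact LieSubalgebra.mem_top M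
  let unitOf : Matrix N N A → GL N A := fun M => if h : IsUnit M then h.unit else 1
  have hunitOf : ∀ u : GL N A, unitOf (u : Matrix N N A) = u := fun u => by
    simp only [unitOf, dif_pos (Units.isUnit u), IsUnit.unit_of_val_units]
  -- the slices of `α` are smooth on all of `𝔤𝔩(N, A)`
  let incl : Matrix N N A →ₗ[ℝ] H.lie.toSubmodule :=
    LinearMap.codRestrict H.lie.toSubmodule LinearMap.id fun M => hmem M
  have hincl : ContDiff ℝ ∞ (incl : Matrix N N A → H.lie.toSubmodule) :=
    (⟨incl, incl.continuous_of_finiteDimensional⟩ : Matrix N N A →L[ℝ] H.lie.toSubmodule).contDiff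
  have hΦ : ∀ g' : GL N A, ContDiff ℝ ∞ fun M : Matrix N N A => α (g' * expGL M) := fun g' =>
    (hα g').comp hincl
  obtain ⟨log, hlog, -, hright⟩ := exists_contDiffAt_log (A := A) (N := N)
  change ContDiffAt ℝ ∞ (fun M : Matrix N N A => α (unitOf M)) (u₀ : Matrix N N A)
  have hP : ContDiff ℝ ∞ fun M : Matrix N N A => ((u₀⁻¹ : GL N A) : Matrix N N A) * M :=
    contDiff_const.mul contDiff_id
  have hP0 : ((u₀⁻¹ : GL N A) : Matrix N N A) * (u₀ : Matrix N N A) = 1 := Units.inv_mul u₀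
  have hG : ContDiffAt ℝ ∞
      (fun M : Matrix N N A => α (u₀ * expGL (log (((u₀⁻¹ : GL N A) : Matrix N N A) * M))))
      (u₀ : Matrix N N A) := by
    have h1 : ContDiffAt ℝ ∞ (fun M : Matrix N N A => log (((u₀⁻¹ : GL N A) : Matrix N N A) * M))
        (u₀ : Matrix N N A) := by
      refine ContDiffAt.comp (u₀ : Matrix N N A) ?_ hP.contDiffAt
      rwa [hP0]
    exact ((hΦ u₀).contDiffAt).comp (u₀ : Matrix N N A) h1
  have hPcont : Tendsto (fun M : Matrix N N A => ((u₀⁻¹ : GL N A) : Matrix N N A) * M)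
      (𝓝 (u₀ : Matrix N N A)) (𝓝 1) := by
    have := hP.continuous.continuousAt (x := (u₀ : Matrix N N A))
    rwa [ContinuousAt, hP0] at this
  refine hG.congr_of_eventuallyEq ?_
  filter_upwards [hPcont.eventually hright] with M hM
  have hMeq : M = ((u₀ * expGL (log (((u₀⁻¹ : GL N A) : Matrix N N A) * M)) : GL N A) :
      Matrix N N A) := by
    rw [Units.val_mul, coe_expGL, hM, Units.mul_inv_cancel_left]
  change α (unitOf M) = α (u₀ * expGL (log (((u₀⁻¹ : GL N A) : Matrix N N A) * M)))
  conv_lhs => rw [hMeq]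
  rw [hunitOf]

set_option backward.isDefEq.respectTransparency false in
open scoped Matrix.Norms.Operator in
/-- **The left-invariant derivative of a test function.** Let `α : GL(N, A) → ℂ` be compactly
supported and smooth (`IsArchSmooth` for the inclusion of the full linear group `H`,
`H.lie = ⊤`; finite-dimensional coefficients), and `X ∈ 𝔤𝔩(N, A)`. Then there is a continuous
compactly supported `α_X : GL(N, A) → ℂ` such that `s ↦ α (exp(-sX) x)` has derivative
`α_X (exp(-tX) x)` at every `t`, for every `x` (`α_X = -X̃ α` for the right-invariant vector field
`X̃`; smoothness on the open set of invertible matrices, `contDiffAt_extend_of_isArchSmooth`, and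
the chain rule along `s ↦ exp(-sX) x`). Borel 1997, 2.1 (right-invariant differential operators
`Y_r`); Knapp 2002, I.§10. [folklore] -/
theorem exists_hasDerivAt_left_translate [FiniteDimensional ℝ A] (hH : H.lie = ⊤)
    {α : GL N A → ℂ} (hαs : HasCompactSupport α)
    (hα : IsArchSmooth H.carrier.subtype α) (X : Matrix N N A) :
    ∃ αX : GL N A → ℂ, Continuous αX ∧ HasCompactSupport αX ∧
      ∀ (x : GL N A) (t : ℝ),
        HasDerivAt (fun s : ℝ => α ((expGL (s • X))⁻¹ * x)) (αX ((expGL (t • X))⁻¹ * x)) t := by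
  classical
  -- the smooth extension `α̃` of `α` to all matrices
  let αt : Matrix N N A → ℂ := fun M => α (if h : IsUnit M then h.unit else 1)
  have hαt : ∀ u₀ : GL N A, ContDiffAt ℝ ∞ αt (u₀ : Matrix N N A) := fun u₀ =>
    contDiffAt_extend_of_isArchSmooth hH hα u₀
  have hαtU : ∀ u : GL N A, αt (u : Matrix N N A) = α u := fun u => by
    simp only [αt, dif_pos (Units.isUnit u), IsUnit.unit_of_val_units]
  -- the derivative `α_X (y) = Dα̃(y)(-X y)`
  let αX : GL N A → ℂ := fun y => fderiv ℝ αt (y : Matrix N N A) (-X * (y : Matrix N N A))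
  have hexp_inv : ∀ s : ℝ, (((expGL (s • X))⁻¹ : GL N A) : Matrix N N A) =
      NormedSpace.exp (s • (-X)) := fun s => by
    rw [← expGL_neg, coe_expGL, smul_neg]
  have hcurve : ∀ (x : GL N A) (s : ℝ), NormedSpace.exp (s • (-X)) * (x : Matrix N N A) =
      ((((expGL (s • X))⁻¹ * x : GL N A)) : Matrix N N A) := fun x s => by
    rw [Units.val_mul, hexp_inv]
  have hderiv : ∀ (x : GL N A) (t : ℝ),
      HasDerivAt (fun s : ℝ => α ((expGL (s • X))⁻¹ * x)) (αX ((expGL (t • X))⁻¹ * x)) t := by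
    intro x t
    have hγ : HasDerivAt (fun s : ℝ => NormedSpace.exp (s • (-X)) * (x : Matrix N N A))
        (-X * NormedSpace.exp (t • (-X)) * (x : Matrix N N A)) t :=
      (hasDerivAt_exp_smul_const' (𝕂 := ℝ) (-X) t).mul_const _
    have hαd : DifferentiableAt ℝ αt (NormedSpace.exp (t • (-X)) * (x : Matrix N N A)) := by
      rw [hcurve]
      exact (hαt _).differentiableAt (by simp)
    have hcomp := hαd.hasFDerivAt.comp_hasDerivAt t hγ
    have hfun : (fun s : ℝ => α ((expGL (s • X))⁻¹ * x)) =
        αt ∘ fun s : ℝ => NormedSpace.exp (s • (-X)) * (x : Matrix N N A) := by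
      funext s
      rw [Function.comp_apply, hcurve, hαtU]
    have hval : fderiv ℝ αt (NormedSpace.exp (t • (-X)) * (x : Matrix N N A))
        (-X * NormedSpace.exp (t • (-X)) * (x : Matrix N N A)) = αX ((expGL (t • X))⁻¹ * x) := by
      simp only [αX]
      rw [Matrix.mul_assoc, hcurve]
    rw [hfun, ← hval]
    exact hcomp
  refine ⟨αX, ?_, ?_, hderiv⟩
  · -- continuity: `y ↦ Dα̃(y)` is continuous at invertible matrices
    refine continuous_iff_continuousAt.2 fun y => ?_
    have h1 : ContinuousAt (fun y : GL N A => fderiv ℝ αt (y : Matrix N N A)) y := by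
      have hf : ContinuousAt (fderiv ℝ αt) ((y : GL N A) : Matrix N N A) :=
        ((hαt y).fderiv_right (m := 1) (WithTop.coe_le_coe.2 le_top)).continuousAt
      exact ContinuousAt.comp (f := (Units.val : GL N A → Matrix N N A)) hf
        Units.continuous_val.continuousAt
    have h2 : ContinuousAt (fun y : GL N A => -X * (y : Matrix N N A)) y :=
      (continuous_const.mul Units.continuous_val).continuousAt
    exact h1.clm_apply h2
  · -- compact support: `α_X` vanishes off the support of `α`
    refine HasCompactSupport.intro' hαs (isClosed_tsupport α) fun y hy => ?_
    -- near `y`, `s ↦ α (exp(-sX) y)` vanishes identically, so its derivative at `0` is `0`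
    have hexpc : Continuous fun s : ℝ => expGL (s • X) := by
      refine Units.continuous_iff.2 ⟨?_, ?_⟩
      · change Continuous fun s : ℝ => ((expGL (s • X) : GL N A) : Matrix N N A)
        simp only [coe_expGL]
        exact NormedSpace.exp_continuous.comp (continuous_id.smul continuous_const)
      · change Continuous fun s : ℝ => (((expGL (s • X))⁻¹ : GL N A) : Matrix N N A)
        simp only [hexp_inv]
        exact NormedSpace.exp_continuous.comp (continuous_id.smul continuous_const)
    have hcont : Continuous fun s : ℝ => (expGL (s • X))⁻¹ * y := hexpc.inv.mul continuous_const
    have h0 : (expGL ((0 : ℝ) • X))⁻¹ * y = y := by rw [zero_smul, expGL_zero, inv_one, one_mul]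
    have hev : ∀ᶠ s in 𝓝 (0 : ℝ), α ((expGL (s • X))⁻¹ * y) = 0 := by
      have hopen : IsOpen (tsupport α)ᶜ := (isClosed_tsupport α).isOpen_compl
      have hy0 : (fun s : ℝ => (expGL (s • X))⁻¹ * y) 0 ∈ (tsupport α)ᶜ := by
        change (expGL ((0 : ℝ) • X))⁻¹ * y ∈ (tsupport α)ᶜ
        rwa [h0]
      filter_upwards [hcont.continuousAt.eventually_mem (hopen.mem_nhds hy0)] with s hs
      exact image_eq_zero_of_notMem_tsupport hs
    have hzero : HasDerivAt (fun s : ℝ => α ((expGL (s • X))⁻¹ * y)) 0 0 :=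
      (hasDerivAt_const (0 : ℝ) (0 : ℂ)).congr_of_eventuallyEq hev
    have h := (hderiv y 0).unique hzero
    rwa [h0] at h

end Weight

end Literature.NumberTheory.Automorphic
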